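import Summits.AtomisticToContinuum.Crystallization.Theorems.DisclinationRationUniformPolytypeStabilityGapPinningDefs

/-!
# `UniformPolytypeStability` (stmt-AtomisticToContinuum-15800), line `birth` (v2, cells): stub `stub_gapPinning`, part 2 (lattice sums)

Route `DisclinationRation`, crux `UniformPolytypeStability`, line `birth` (lead prover-line-stmt-AtomisticToContinuum-15800-0).
Elementary analysis of the 2D lattice sums `Alat k c η = Σ_{p ∈ ℤ²} (Qf c p + η²)^{-k}` of the definitions file
`…GapPinningDefs` (namespace `StubGapPinning`):

* the square box / shell combinatorics (`box N = {max(|u|,|v|) ≤ N}`, `|box N| = (2N+1)²`, `|shell n| = 8n`);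
* the in-plane form `Qf c (u,v) = q(u + c/3, v + c/3)`, `q(x,y) = x² + xy + y² ≥ (3/4) max(x², y²)`, hence
  `Qf c p ≥ (3/4)(n − 1/3)²` on shell `n` for `|c| ≤ 1`;
* summability of `(Qf c p + η²)^{-k}` (`k ≥ 4`) with the explicit SHELL-TELESCOPING tail
  `0 ≤ Alat k c η − SN k N c η ≤ tauB N η = β_{N+1} ((3/4)(N−1/3)² + η²)^{-3}` (`β_n = 32n/(18n−15)`), from
  `8n y_n⁻⁴ ≤ β (y_{n-1}⁻³ − y_n⁻³)`;
* reduction of the registry class `Alat k c = Alat k (cls c)` (translation by `(m,m)` and point reflection of `ℤ²`),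
  monotonicity in `η`, the crude bound `Alat 4 c η ≤ 49 η⁻⁸ + β₄ η⁻⁶`, and the fixed-point sandwich
  `sumLo ≤ 2⁶⁰ · SN ≤ sumLo + (2N+1)²` of the certificate sums.

Everything is `[folklore]`; theorem-only file; nothing here closes an item.  `stub_gapPinningAux2` is the registered anchor.
-/

noncomputable section

namespace Summit.AtomisticToContinuum.Crystallization.Theorems.UniformPolytypeStabilityCells

namespace StubGapPinning

open scoped BigOperators
open Finset

/-! ## Box and shells -/

/-- Membership in the computable range `rng N = [-N, N]`. [folklore] -/
theorem mem_rng {N : ℕ} {x : ℤ} : x ∈ rng N ↔ -(N : ℤ) ≤ x ∧ x ≤ N := by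
  simp only [rng, Finset.mem_map, Finset.mem_range, Function.Embedding.coeFn_mk]
  constructor
  · rintro ⟨i, hi, rfl⟩; omega
  · rintro ⟨h1, h2⟩; exact ⟨(x + N).toNat, by omega, by omega⟩

/-- Membership in the box: `p ∈ box N ↔ max(|u|,|v|) ≤ N`. [folklore] -/
theorem mem_box {N : ℕ} {p : ℤ × ℤ} : p ∈ box N ↔ sqRing p ≤ N := by
  simp only [box, Finset.mem_product, mem_rng, sqRing, max_le_iff]
  omega

/-- `|box N| = (2N+1)²` for the computable box of `…GapPinningDefs` (a `Finset.map` image, not the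
`Icc`-product `StackingSums.box` of the literature file `HcpFccLatticeSums`). [folklore] -/
theorem card_box (N : ℕ) : Finset.card (box N) = (2 * N + 1) ^ 2 := by
  simp [box, rng, sq]

/-- Membership in a shell: `p ∈ shell n ↔ max(|u|,|v|) = n`. [folklore] -/
theorem mem_shell {n : ℕ} {p : ℤ × ℤ} : p ∈ shell n ↔ sqRing p = n := by
  simp only [shell, Finset.mem_filter, mem_box]
  omega

/-- `|shell n| = 8n` for `n ≥ 1`. [folklore] -/
theorem card_shell {n : ℕ} (hn : 1 ≤ n) : (shell n).card = 8 * n := by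
  have h1 : shell n = box n \ box (n - 1) := by
    ext p; simp only [mem_shell, Finset.mem_sdiff, mem_box]; omega
  have h2 : box (n - 1) ⊆ box n := fun p hp => by rw [mem_box] at hp ⊢; omega
  have h3 := Finset.card_sdiff_add_card_eq_card h2
  rw [← h1, card_box, card_box] at h3
  obtain ⟨m, rfl⟩ : ∃ m, n = m + 1 := ⟨n - 1, by omega⟩
  simp only [Nat.add_sub_cancel] at h3
  nlinarith [h3]

/-- The part of a larger box outside `box N` decomposes into the shells `N < n ≤ N'`. [folklore] -/
theorem sum_sdiff_box_eq (f : ℤ × ℤ → ℝ) (N N' : ℕ) :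
    ∑ p ∈ box N' \ box N, f p = ∑ n ∈ Finset.Ioc N N', ∑ p ∈ shell n, f p := by
  have hmaps : ∀ p ∈ box N' \ box N, sqRing p ∈ Finset.Ioc N N' := fun p hp => by
    simp only [Finset.mem_sdiff, mem_box] at hp; simp only [Finset.mem_Ioc]; omega
  rw [← Finset.sum_fiberwise_of_maps_to hmaps]
  refine Finset.sum_congr rfl fun n hn => Finset.sum_congr ?_ fun _ _ => rfl
  ext p
  simp only [Finset.mem_filter, Finset.mem_sdiff, mem_box, mem_shell, Finset.mem_Ioc] at hn ⊢
  omega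

/-- A finite set of in-plane indices lies in some box containing `box N`. [folklore] -/
theorem exists_subset_box (u : Finset (ℤ × ℤ)) (N : ℕ) : ∃ N', N ≤ N' ∧ u ⊆ box N' := by
  refine ⟨N + u.sup sqRing, by omega, fun p hp => ?_⟩
  rw [mem_box]
  exact (Finset.le_sup hp).trans (by omega)

/-! ## The in-plane form -/

/-- `Qf c (u,v) = q(u + c/3, v + c/3)` with `q(x,y) = x² + xy + y²`. [folklore] -/
theorem Qf_cast (c : ℤ) (p : ℤ × ℤ) : (Qf c p : ℝ) =
    ((p.1 : ℝ) + c / 3) ^ 2 + ((p.1 : ℝ) + c / 3) * ((p.2 : ℝ) + c / 3) + ((p.2 : ℝ) + c / 3) ^ 2 := by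
  simp only [Qf]; push_cast; ring

/-- `Qf ≥ 0`. [folklore] -/
theorem Qf_nonneg (c : ℤ) (p : ℤ × ℤ) : 0 ≤ (Qf c p : ℝ) := by
  rw [Qf_cast]; nlinarith [sq_nonneg ((p.1 : ℝ) + c / 3 + ((p.2 : ℝ) + c / 3) / 2)]

/-- `q(x,y) ≥ (3/4) x²` and `≥ (3/4) y²`. [folklore] -/
theorem Qf_ge_coord (c : ℤ) (p : ℤ × ℤ) :
    3 / 4 * ((p.1 : ℝ) + c / 3) ^ 2 ≤ (Qf c p : ℝ) ∧ 3 / 4 * ((p.2 : ℝ) + c / 3) ^ 2 ≤ (Qf c p : ℝ) := by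
  rw [Qf_cast]
  constructor
  · nlinarith [sq_nonneg ((p.2 : ℝ) + c / 3 + ((p.1 : ℝ) + c / 3) / 2)]
  · nlinarith [sq_nonneg ((p.1 : ℝ) + c / 3 + ((p.2 : ℝ) + c / 3) / 2)]

/-- On shell `n ≥ 1`, for `|c| ≤ 1`: `Qf c p ≥ (3/4)(n − 1/3)²`. [folklore] -/
theorem Qf_ge_shell {c : ℤ} (hc : |c| ≤ 1) {n : ℕ} (hn : 1 ≤ n) {p : ℤ × ℤ} (hp : sqRing p = n) :
    3 / 4 * ((n : ℝ) - 1 / 3) ^ 2 ≤ (Qf c p : ℝ) := by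
  have hc' : |(c : ℝ)| ≤ 1 := by exact_mod_cast hc
  obtain ⟨hc1, hc2⟩ := abs_le.1 hc'
  have hn' : (1 : ℝ) ≤ n := by exact_mod_cast hn
  obtain ⟨h1, h2⟩ := Qf_ge_coord c p
  simp only [sqRing] at hp
  rcases le_total p.2.natAbs p.1.natAbs with h | h
  · have hu : (p.1.natAbs : ℤ) = n := by rw [max_eq_left h] at hp; exact_mod_cast hp
    rcases Int.natAbs_eq p.1 with h' | h'
    · have : (p.1 : ℝ) = n := by exact_mod_cast (h'.trans hu)
      nlinarith [this]
    · have : (p.1 : ℝ) = -n := by rw [hu] at h'; exact_mod_cast h'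
      nlinarith [this]
  · have hu : (p.2.natAbs : ℤ) = n := by rw [max_eq_right h] at hp; exact_mod_cast hp
    rcases Int.natAbs_eq p.2 with h' | h'
    · have : (p.2 : ℝ) = n := by exact_mod_cast (h'.trans hu)
      nlinarith [this]
    · have : (p.2 : ℝ) = -n := by rw [hu] at h'; exact_mod_cast h'
      nlinarith [this]

/-! ## The summands, shells and the telescoping tail -/

/-- The summand `gk k c η p = (Qf c p + η²)^{-k}` is nonnegative. [folklore] -/
theorem term_nonneg (k : ℕ) (c : ℤ) (η : ℝ) (p : ℤ × ℤ) : 0 ≤ ((Qf c p : ℝ) + η ^ 2)⁻¹ ^ k :=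
  pow_nonneg (inv_nonneg.2 (add_nonneg (Qf_nonneg c p) (sq_nonneg η))) k

/-- On shell `n ≥ 2` (`|c| ≤ 1`, `k ≥ 4`): every summand is `≤ y_n⁻⁴`, `y_n = (3/4)(n−1/3)² + η²`. [folklore] -/
theorem term_le_shell {k : ℕ} (hk : 4 ≤ k) {c : ℤ} (hc : |c| ≤ 1) (η : ℝ) {n : ℕ} (hn : 2 ≤ n) {p : ℤ × ℤ}
    (hp : sqRing p = n) :
    ((Qf c p : ℝ) + η ^ 2)⁻¹ ^ k ≤ ((3 / 4 * ((n : ℝ) - 1 / 3) ^ 2 + η ^ 2)⁻¹) ^ 4 := by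
  have hQ := Qf_ge_shell hc (by omega) hp
  have hn' : (2 : ℝ) ≤ n := by exact_mod_cast hn
  have hy1 : 1 ≤ 3 / 4 * ((n : ℝ) - 1 / 3) ^ 2 + η ^ 2 := by nlinarith [sq_nonneg η]
  have hx1 : 1 ≤ (Qf c p : ℝ) + η ^ 2 := by linarith
  have hxpos : 0 < (Qf c p : ℝ) + η ^ 2 := by linarith
  have hQ' : 3 / 4 * ((n : ℝ) - 1 / 3) ^ 2 + η ^ 2 ≤ (Qf c p : ℝ) + η ^ 2 := by linarith
  calc ((Qf c p : ℝ) + η ^ 2)⁻¹ ^ k ≤ ((Qf c p : ℝ) + η ^ 2)⁻¹ ^ 4 :=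
        pow_le_pow_of_le_one (inv_nonneg.2 hxpos.le) (inv_le_one_of_one_le₀ hx1) hk
    _ ≤ ((3 / 4 * ((n : ℝ) - 1 / 3) ^ 2 + η ^ 2)⁻¹) ^ 4 :=
        pow_le_pow_left₀ (inv_nonneg.2 hxpos.le) (inv_anti₀ (by linarith) hQ') 4

/-- The shell sum is at most `8n · y_n⁻⁴`. [folklore] -/
theorem shell_sum_le {k : ℕ} (hk : 4 ≤ k) {c : ℤ} (hc : |c| ≤ 1) (η : ℝ) {n : ℕ} (hn : 2 ≤ n) :
    ∑ p ∈ shell n, ((Qf c p : ℝ) + η ^ 2)⁻¹ ^ k ≤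
      8 * n * ((3 / 4 * ((n : ℝ) - 1 / 3) ^ 2 + η ^ 2)⁻¹) ^ 4 := by
  calc ∑ p ∈ shell n, ((Qf c p : ℝ) + η ^ 2)⁻¹ ^ k
      ≤ ∑ _p ∈ shell n, ((3 / 4 * ((n : ℝ) - 1 / 3) ^ 2 + η ^ 2)⁻¹) ^ 4 :=
        Finset.sum_le_sum fun p hp => term_le_shell hk hc η hn (mem_shell.1 hp)
    _ = 8 * n * ((3 / 4 * ((n : ℝ) - 1 / 3) ^ 2 + η ^ 2)⁻¹) ^ 4 := by
        rw [Finset.sum_const, card_shell (by omega), nsmul_eq_mul]; push_cast; ring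

/-- The telescoping inequality `8n y_n⁻⁴ ≤ β (y_{n-1}⁻³ − y_n⁻³)` for `n ≥ n₀ ≥ 2`, `β = 32n₀/(18n₀−15)`. [folklore] -/
theorem shell_telescope (η : ℝ) {n₀ n : ℕ} (hn₀ : 2 ≤ n₀) (hn : n₀ ≤ n) :
    8 * (n : ℝ) * ((3 / 4 * ((n : ℝ) - 1 / 3) ^ 2 + η ^ 2)⁻¹) ^ 4 ≤
      32 * (n₀ : ℝ) / (18 * (n₀ : ℝ) - 15) * (((3 / 4 * ((n : ℝ) - 1 - 1 / 3) ^ 2 + η ^ 2)⁻¹) ^ 3 -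
        ((3 / 4 * ((n : ℝ) - 1 / 3) ^ 2 + η ^ 2)⁻¹) ^ 3) := by
  have hn₀' : (2 : ℝ) ≤ n₀ := by exact_mod_cast hn₀
  have hn' : (n₀ : ℝ) ≤ n := by exact_mod_cast hn
  set y₁ : ℝ := 3 / 4 * ((n : ℝ) - 1 - 1 / 3) ^ 2 + η ^ 2 with hy₁
  set y₂ : ℝ := 3 / 4 * ((n : ℝ) - 1 / 3) ^ 2 + η ^ 2 with hy₂
  set β : ℝ := 32 * (n₀ : ℝ) / (18 * (n₀ : ℝ) - 15) with hβ
  have hy₁pos : 0 < y₁ := by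
    have : (0 : ℝ) < ((n : ℝ) - 1 - 1 / 3) ^ 2 := by nlinarith
    nlinarith [sq_nonneg η]
  have hy₁₂ : y₁ ≤ y₂ := by simp only [hy₁, hy₂]; nlinarith
  have hy₂pos : 0 < y₂ := lt_of_lt_of_le hy₁pos hy₁₂
  have hdiff : y₂ - y₁ = 3 / 4 * (2 * n - 5 / 3) := by simp only [hy₁, hy₂]; ring
  have hden : 0 < 18 * (n₀ : ℝ) - 15 := by linarith
  have hβpos : 0 < β := div_pos (by linarith) hden
  -- β (9/4)(2n − 5/3) ≥ 8 n
  have hβn : 8 * (n : ℝ) ≤ β * (9 / 4 * (2 * n - 5 / 3)) := by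
    rw [hβ, div_mul_eq_mul_div, le_div_iff₀ hden]; nlinarith
  -- y₁⁻³ − y₂⁻³ − 3 (y₂ − y₁) y₂⁻⁴ = (y₂ − y₁)² (y₂² + 2 y₁ y₂ + 3 y₁²) y₁⁻³ y₂⁻⁴ ≥ 0
  have hcube : 3 * (y₂ - y₁) * (y₂⁻¹) ^ 4 ≤ (y₁⁻¹) ^ 3 - (y₂⁻¹) ^ 3 := by
    have hne₁ : y₁ ≠ 0 := hy₁pos.ne'
    have hne₂ : y₂ ≠ 0 := hy₂pos.ne'
    have : (y₁⁻¹) ^ 3 - (y₂⁻¹) ^ 3 - 3 * (y₂ - y₁) * (y₂⁻¹) ^ 4 =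
        (y₂ - y₁) ^ 2 * (y₂ ^ 2 + 2 * y₁ * y₂ + 3 * y₁ ^ 2) * ((y₁⁻¹) ^ 3 * (y₂⁻¹) ^ 4) := by
      field_simp; ring
    nlinarith [this, mul_nonneg (mul_nonneg (sq_nonneg (y₂ - y₁)) (by positivity : (0 : ℝ) ≤
      y₂ ^ 2 + 2 * y₁ * y₂ + 3 * y₁ ^ 2)) (by positivity : (0 : ℝ) ≤ (y₁⁻¹) ^ 3 * (y₂⁻¹) ^ 4)]
  calc 8 * (n : ℝ) * (y₂⁻¹) ^ 4 ≤ β * (9 / 4 * (2 * n - 5 / 3)) * (y₂⁻¹) ^ 4 :=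
        mul_le_mul_of_nonneg_right hβn (by positivity)
    _ = β * (3 * (y₂ - y₁) * (y₂⁻¹) ^ 4) := by rw [hdiff]; ring
    _ ≤ β * ((y₁⁻¹) ^ 3 - (y₂⁻¹) ^ 3) := mul_le_mul_of_nonneg_left hcube hβpos.le

/-- Telescoped shell sums: `Σ_{N < n ≤ N'} 8n y_n⁻⁴ ≤ β_{N+1} y_N⁻³` (`N ≥ 1`). [folklore] -/
theorem sum_shell_bound_le (η : ℝ) {N : ℕ} (hN : 1 ≤ N) (N' : ℕ) :
    ∑ n ∈ Finset.Ioc N N', 8 * (n : ℝ) * ((3 / 4 * ((n : ℝ) - 1 / 3) ^ 2 + η ^ 2)⁻¹) ^ 4 ≤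
      32 * ((N + 1 : ℕ) : ℝ) / (18 * ((N + 1 : ℕ) : ℝ) - 15) *
        ((3 / 4 * ((N : ℝ) - 1 / 3) ^ 2 + η ^ 2)⁻¹) ^ 3 := by
  set B : ℕ → ℝ := fun n => ((3 / 4 * ((n : ℝ) - 1 / 3) ^ 2 + η ^ 2)⁻¹) ^ 3 with hB
  set β : ℝ := 32 * ((N + 1 : ℕ) : ℝ) / (18 * ((N + 1 : ℕ) : ℝ) - 15) with hβ
  have hβpos : 0 ≤ β := by
    rw [hβ]; exact div_nonneg (by positivity) (by push_cast; linarith)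
  have key : ∀ N', N ≤ N' → ∑ n ∈ Finset.Ioc N N', 8 * (n : ℝ) *
      ((3 / 4 * ((n : ℝ) - 1 / 3) ^ 2 + η ^ 2)⁻¹) ^ 4 ≤ β * (B N - B N') := by
    intro N' hNN'
    induction N', hNN' using Nat.le_induction with
    | base => simp
    | succ M hM ih =>
      rw [Finset.sum_Ioc_succ_top (by omega), show B (M + 1) = B M - (B M - B (M + 1)) by ring, mul_sub]
      have h := shell_telescope η (n₀ := N + 1) (n := M + 1) (by omega) (by omega)
      have hB' : B M = ((3 / 4 * (((M + 1 : ℕ) : ℝ) - 1 - 1 / 3) ^ 2 + η ^ 2)⁻¹) ^ 3 := by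
        simp only [hB]; push_cast; ring_nf
      rw [hB'] at ih ⊢
      simp only [hB, hβ] at ih h ⊢
      linarith
  rcases le_or_gt N N' with h | h
  · refine (key N' h).trans ?_
    have : 0 ≤ B N' := by simp only [hB]; exact pow_nonneg (inv_nonneg.2 (by positivity)) 3
    nlinarith
  · rw [Finset.Ioc_eq_empty (by omega), Finset.sum_empty]
    exact mul_nonneg hβpos (pow_nonneg (inv_nonneg.2 (by positivity)) 3)

/-! ## Summability and the tail bound -/

/-- The real tail constant `tauR N η = β_{N+1} y_N⁻³` (the cast of `tauB`). [folklore] -/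
theorem tauB_cast (N : ℕ) (e : ℚ) : ((tauB N e : ℚ) : ℝ) =
    32 * ((N + 1 : ℕ) : ℝ) / (18 * ((N + 1 : ℕ) : ℝ) - 15) *
      ((3 / 4 * ((N : ℝ) - 1 / 3) ^ 2 + (e : ℝ) ^ 2)⁻¹) ^ 3 := by
  simp only [tauB, betaC, div_eq_mul_inv, inv_pow]; push_cast; ring

/-- Every finite partial sum is at most the truncated sum plus the shell tail (`k ≥ 4`, `|c| ≤ 1`, `N ≥ 1`). [folklore] -/
theorem sum_le_SN_add_tail {k : ℕ} (hk : 4 ≤ k) {c : ℤ} (hc : |c| ≤ 1) {N : ℕ} (hN : 1 ≤ N) (η : ℝ)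
    (u : Finset (ℤ × ℤ)) :
    ∑ p ∈ u, ((Qf c p : ℝ) + η ^ 2)⁻¹ ^ k ≤ SN k N c η +
      32 * ((N + 1 : ℕ) : ℝ) / (18 * ((N + 1 : ℕ) : ℝ) - 15) * ((3 / 4 * ((N : ℝ) - 1 / 3) ^ 2 + η ^ 2)⁻¹) ^ 3 := by
  obtain ⟨N', hNN', hu⟩ := exists_subset_box u N
  have hsub : box N ⊆ box N' := fun p hp => by rw [mem_box] at hp ⊢; omega
  calc ∑ p ∈ u, ((Qf c p : ℝ) + η ^ 2)⁻¹ ^ k ≤ ∑ p ∈ box N', ((Qf c p : ℝ) + η ^ 2)⁻¹ ^ k :=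
        Finset.sum_le_sum_of_subset_of_nonneg hu fun p _ _ => term_nonneg k c η p
    _ = SN k N c η + ∑ p ∈ box N' \ box N, ((Qf c p : ℝ) + η ^ 2)⁻¹ ^ k := by
        rw [SN, add_comm, Finset.sum_sdiff hsub]
    _ = SN k N c η + ∑ n ∈ Finset.Ioc N N', ∑ p ∈ shell n, ((Qf c p : ℝ) + η ^ 2)⁻¹ ^ k := by
        rw [sum_sdiff_box_eq]
    _ ≤ SN k N c η + ∑ n ∈ Finset.Ioc N N', 8 * (n : ℝ) * ((3 / 4 * ((n : ℝ) - 1 / 3) ^ 2 + η ^ 2)⁻¹) ^ 4 := by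
        gcongr with n hn
        exact shell_sum_le hk hc η (by simp only [Finset.mem_Ioc] at hn; omega)
    _ ≤ _ := by gcongr; exact sum_shell_bound_le η hN N'

/-- Summability of `(Qf c p + η²)^{-k}` over `ℤ²` for `|c| ≤ 1`, `k ≥ 4`. [folklore] -/
theorem summable_term_of_abs_le {k : ℕ} (hk : 4 ≤ k) {c : ℤ} (hc : |c| ≤ 1) (η : ℝ) :
    Summable fun p : ℤ × ℤ => ((Qf c p : ℝ) + η ^ 2)⁻¹ ^ k :=
  summable_of_sum_le (fun p => term_nonneg k c η p) (sum_le_SN_add_tail hk hc le_rfl η)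

/-- `Alat ≤ SN + tail` for `|c| ≤ 1`, `k ≥ 4`, `N ≥ 1`. [folklore] -/
theorem Alat_le_SN_add_tail {k : ℕ} (hk : 4 ≤ k) {c : ℤ} (hc : |c| ≤ 1) {N : ℕ} (hN : 1 ≤ N) (η : ℝ) :
    Alat k c η ≤ SN k N c η +
      32 * ((N + 1 : ℕ) : ℝ) / (18 * ((N + 1 : ℕ) : ℝ) - 15) * ((3 / 4 * ((N : ℝ) - 1 / 3) ^ 2 + η ^ 2)⁻¹) ^ 3 :=
  Real.tsum_le_of_sum_le (fun p => term_nonneg k c η p) (sum_le_SN_add_tail hk hc hN η)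

/-- `SN ≤ Alat` for `|c| ≤ 1`, `k ≥ 4`. [folklore] -/
theorem SN_le_Alat {k : ℕ} (hk : 4 ≤ k) {c : ℤ} (hc : |c| ≤ 1) (N : ℕ) (η : ℝ) : SN k N c η ≤ Alat k c η :=
  (summable_term_of_abs_le hk hc η).sum_le_tsum (box N) fun p _ => term_nonneg k c η p

/-- `Alat ≤ SN + tauB` at a rational point (the form the certificate uses). [folklore] -/
theorem Alat_le_SN_add_tauB {k : ℕ} (hk : 4 ≤ k) {c : ℤ} (hc : |c| ≤ 1) {N : ℕ} (hN : 1 ≤ N) (e : ℚ) :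
    Alat k c e ≤ SN k N c e + (tauB N e : ℚ) := by
  rw [tauB_cast]; exact Alat_le_SN_add_tail hk hc hN e

/-! ## Reduction of the registry class -/

/-- Translation: `Qf (3m + r) (u,v) = Qf r (u+m, v+m)`. [folklore] -/
theorem Qf_shift (m r : ℤ) (p : ℤ × ℤ) : Qf (3 * m + r) p = Qf r (p.1 + m, p.2 + m) := by
  simp only [Qf]; push_cast; ring

/-- Point reflection: `Qf (-r) (u,v) = Qf r (-u,-v)`. [folklore] -/
theorem Qf_neg (r : ℤ) (p : ℤ × ℤ) : Qf (-r) p = Qf r (-p.1, -p.2) := by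
  simp only [Qf]; push_cast; ring

/-- `Alat k (3m + r) = Alat k r`. [folklore] -/
theorem Alat_shift (k : ℕ) (m r : ℤ) (η : ℝ) : Alat k (3 * m + r) η = Alat k r η := by
  rw [Alat, Alat, ← (Equiv.addRight ((m, m) : ℤ × ℤ)).tsum_eq fun p : ℤ × ℤ => ((Qf r p : ℝ) + η ^ 2)⁻¹ ^ k]
  refine tsum_congr fun p => ?_
  obtain ⟨u, v⟩ := p
  simp [Qf_shift]

/-- `Alat k (-r) = Alat k r`. [folklore] -/
theorem Alat_neg (k : ℕ) (r : ℤ) (η : ℝ) : Alat k (-r) η = Alat k r η := by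
  rw [Alat, Alat, ← (Equiv.neg (ℤ × ℤ)).tsum_eq fun p : ℤ × ℤ => ((Qf r p : ℝ) + η ^ 2)⁻¹ ^ k]
  refine tsum_congr fun p => ?_
  obtain ⟨u, v⟩ := p
  simp [Qf_neg]

/-- `|cls c| ≤ 1`. [folklore] -/
theorem abs_cls_le (c : ℤ) : |cls c| ≤ 1 := by
  unfold cls; split_ifs <;> simp

/-- The lattice sum depends on `c` only through its class: `Alat k c = Alat k (cls c)`. [folklore] -/
theorem Alat_cls (k : ℕ) (c : ℤ) (η : ℝ) : Alat k c η = Alat k (cls c) η := by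
  unfold cls
  split_ifs with h
  · obtain ⟨m, rfl⟩ := h
    simpa using Alat_shift k m 0 η
  · have h3 : c % 3 = 1 ∨ c % 3 = 2 := by omega
    have hc : c = 3 * (c / 3) + c % 3 := (Int.mul_ediv_add_emod c 3).symm
    rcases h3 with h1 | h2
    · rw [hc, h1, Alat_shift]
    · rw [show c = 3 * (c / 3 + 1) + (-1) by omega, Alat_shift, Alat_neg]

/-- Summability of `(Qf c p + η²)^{-k}` over `ℤ²` for every `c`, `k ≥ 4`. [folklore] -/
theorem summable_term {k : ℕ} (hk : 4 ≤ k) (c : ℤ) (η : ℝ) :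
    Summable fun p : ℤ × ℤ => ((Qf c p : ℝ) + η ^ 2)⁻¹ ^ k := by
  have hc : c = 3 * (c / 3) + c % 3 := (Int.mul_ediv_add_emod c 3).symm
  have key : ∀ r : ℤ, |r| ≤ 1 → ∀ m : ℤ, Summable fun p : ℤ × ℤ => ((Qf (3 * m + r) p : ℝ) + η ^ 2)⁻¹ ^ k := by
    intro r hr m
    have h := (Equiv.addRight ((m, m) : ℤ × ℤ)).summable_iff.2 (summable_term_of_abs_le hk hr η)
    refine h.congr fun p => ?_
    obtain ⟨u, v⟩ := p
    simp [Qf_shift]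
  have h3 : c % 3 = 0 ∨ c % 3 = 1 ∨ c % 3 = 2 := by omega
  rcases h3 with h0 | h1 | h2
  · rw [hc, h0]; exact key 0 (by simp) _
  · rw [hc, h1]; exact key 1 (by simp) _
  · rw [show c = 3 * (c / 3 + 1) + (-1) by omega]; exact key (-1) (by simp) _

/-! ## Monotonicity in `η` and the crude decay bound -/

/-- Each summand is antitone in `η > 0`. [folklore] -/
theorem term_anti (k : ℕ) (c : ℤ) (p : ℤ × ℤ) {η η' : ℝ} (hη : 0 < η) (hle : η ≤ η') :
    ((Qf c p : ℝ) + η' ^ 2)⁻¹ ^ k ≤ ((Qf c p : ℝ) + η ^ 2)⁻¹ ^ k := by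
  have h0 : 0 < (Qf c p : ℝ) + η ^ 2 := by nlinarith [Qf_nonneg c p]
  exact pow_le_pow_left₀ (inv_nonneg.2 (by nlinarith [Qf_nonneg c p])) (inv_anti₀ h0 (by nlinarith)) k

/-- `SN` is antitone in `η > 0`. [folklore] -/
theorem SN_anti (k N : ℕ) (c : ℤ) {η η' : ℝ} (hη : 0 < η) (hle : η ≤ η') : SN k N c η' ≤ SN k N c η :=
  Finset.sum_le_sum fun p _ => term_anti k c p hη hle

/-- `SN ≥ 0`. [folklore] -/
theorem SN_nonneg (k N : ℕ) (c : ℤ) (η : ℝ) : 0 ≤ SN k N c η :=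
  Finset.sum_nonneg fun p _ => term_nonneg k c η p

/-- `Alat` is antitone in `η > 0` (`k ≥ 4`). [folklore] -/
theorem Alat_anti {k : ℕ} (hk : 4 ≤ k) (c : ℤ) {η η' : ℝ} (hη : 0 < η) (hle : η ≤ η') :
    Alat k c η' ≤ Alat k c η :=
  (summable_term hk c η').tsum_le_tsum (fun p => term_anti k c p hη hle) (summable_term hk c η)

/-- `Alat ≥ 0`. [folklore] -/
theorem Alat_nonneg (k : ℕ) (c : ℤ) (η : ℝ) : 0 ≤ Alat k c η := tsum_nonneg fun p => term_nonneg k c η p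

/-- Crude decay: `Alat 4 c η ≤ 49 η⁻⁸ + (128/57) η⁻⁶` for `|c| ≤ 1`, `η > 0` (box `N = 3` plus tail). [folklore] -/
theorem Alat_four_le {c : ℤ} (hc : |c| ≤ 1) {η : ℝ} (hη : 0 < η) :
    Alat 4 c η ≤ 49 * (η⁻¹) ^ 8 + 128 / 57 * (η⁻¹) ^ 6 := by
  have h := Alat_le_SN_add_tail (k := 4) le_rfl hc (N := 3) (by norm_num) η
  have hSN : SN 4 3 c η ≤ 49 * (η⁻¹) ^ 8 := by
    calc SN 4 3 c η ≤ ∑ _p ∈ box 3, (η ^ 2)⁻¹ ^ 4 := Finset.sum_le_sum fun p _ =>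
          pow_le_pow_left₀ (inv_nonneg.2 (by nlinarith [Qf_nonneg c p]))
            (inv_anti₀ (by positivity) (by nlinarith [Qf_nonneg c p])) 4
      _ = 49 * (η⁻¹) ^ 8 := by rw [Finset.sum_const, card_box, nsmul_eq_mul, inv_pow, inv_pow]; norm_num; ring
  have htail : ((3 / 4 * ((3 : ℕ) - 1 / 3 : ℝ) ^ 2 + η ^ 2)⁻¹) ^ 3 ≤ (η⁻¹) ^ 6 := by
    rw [show (η⁻¹) ^ 6 = ((η ^ 2)⁻¹) ^ 3 by rw [inv_pow, inv_pow]; ring]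
    exact pow_le_pow_left₀ (inv_nonneg.2 (by positivity)) (inv_anti₀ (by positivity) (by nlinarith)) 3
  have hβ : 32 * ((3 + 1 : ℕ) : ℝ) / (18 * ((3 + 1 : ℕ) : ℝ) - 15) = 128 / 57 := by norm_num
  rw [hβ] at h
  nlinarith [h, hSN, htail]

/-! ## The fixed-point sandwich of the certificate sums -/

/-- `SN` at a rational point is the cast of the exact rational sum. [folklore] -/
theorem SN_ratCast (k N : ℕ) (c : ℤ) (e : ℚ) :
    SN k N c e = ((∑ p ∈ box N, ((Qf c p + e ^ 2)⁻¹) ^ k : ℚ) : ℝ) := by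
  simp only [SN]; push_cast; rfl

/-- `sumLo ≤ 2⁶⁰ · SN`. [folklore] -/
theorem sumLo_le (k N : ℕ) (c : ℤ) (e : ℚ) : (sumLo k N c e : ℝ) ≤ (Mfp : ℝ) * SN k N c e := by
  rw [SN_ratCast]
  have h : (sumLo k N c e : ℚ) ≤ (Mfp : ℚ) * ∑ p ∈ box N, ((Qf c p + e ^ 2)⁻¹) ^ k := by
    rw [sumLo, Finset.mul_sum]; push_cast
    exact Finset.sum_le_sum fun p _ => Int.floor_le _
  exact_mod_cast h

/-- `2⁶⁰ · SN ≤ sumLo + (2N+1)²`. [folklore] -/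
theorem SN_le_sumLo (k N : ℕ) (c : ℤ) (e : ℚ) :
    (Mfp : ℝ) * SN k N c e ≤ (sumLo k N c e : ℝ) + (((2 * N + 1) ^ 2 : ℕ) : ℝ) := by
  rw [SN_ratCast]
  have h : (Mfp : ℚ) * ∑ p ∈ box N, ((Qf c p + e ^ 2)⁻¹) ^ k ≤ (sumLo k N c e : ℚ) + (((2 * N + 1) ^ 2 : ℕ) : ℚ) := by
    rw [sumLo, Finset.mul_sum, ← card_box N, Finset.card_eq_sum_ones (box N)]
    push_cast
    rw [← Finset.sum_add_distrib]
    exact Finset.sum_le_sum fun p _ => (Int.lt_floor_add_one _).le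
  exact_mod_cast h

end StubGapPinning

/-- Registered anchor `stub_gapPinningAux2` of the lattice-sum file of `stub_gapPinning`: the square shell
`{max(|u|,|v|) = 2}` has `16` points and the class reduction `Alat k 5 = Alat k 1` (`5 = 3·2 − 1`). [folklore] -/
theorem stub_gapPinningAux2 : (StubGapPinning.shell 2).card = 16 ∧
    ∀ (k : ℕ) (η : ℝ), StubGapPinning.Alat k 5 η = StubGapPinning.Alat k 1 η :=
  ⟨StubGapPinning.card_shell (by norm_num), fun k η => by
    rw [StubGapPinning.Alat_cls]; rfl⟩

end Summit.AtomisticToContinuum.Crystallization.Theorems.UniformPolytypeStabilityCells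

end
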